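import Literature.GroupTheory.FreeNormalSubgroupCompletionCentralizer
import Literature.GroupTheory.SlimNormalExtension
import Literature.AnabelianGeometry.AbsoluteAnabelian.ProfiniteSlimAscentSharp
import HarnessLib

/-!
# The profinite completion of a group with a free normal subgroup of finite index and trivial
# centraliser is SLIM

Topic `Literature/GroupTheory` (abc-iut cell, campaign-L residual «J2»; [AbsTopIII] Lemma 4.3 "the
profinite group `Π_{[X/Aut X]}` is slim" as used in the proof of Prop. 4.2 (i), kurims p. 106, for a
hyperbolic Riemann surface `X = ℍ/Λ̄` with `Λ̄` FREE: `Π_{[X/Aut X]} = N_{PSL₂(ℝ)}(Λ̄)^`).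

PROOF-ONLY companion (no definition, no named fact) of `FreeNormalSubgroupCompletionCentralizer.lean`
(`eq_one_of_forall_commute_toCompletion`: `C_{M̂}(η Λ) = 1`) and `SlimNormalExtension.lean`
(`IsSlimGroup.of_normal_of_centralizer_eq_bot`):

* `isSlimGroup_completion_of_isFreeGroup_normal` — for `Λ ⊴ M` normal of finite index, free, with
  `C_M(Λ) = 1`, the profinite completion `M̂` is SLIM: the closure `Λ̂` of `η(Λ)` is a normal subgroup
  (kernel of `M̂ → M/Λ`), isomorphic as a topological group to the completion of the free group `Λ`
  (comparison `exists_comparison` + compact-to-Hausdorff), hence slim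
  (`isSlimGroup_profiniteCompletion_of_isFreeGroup`), with `C_{M̂}(Λ̂) = 1` by the main theorem;
* `eq_one_of_forall_commute_etaFn_normalizer`, `isSlimGroup_completion_normalizer` — the same two
  statements in the NORMALISER shape consumed by abc-iut-L4-t14
  (`LocObj.isIdRigid_of_completion_normalizer`, `HolRS.isIdRigid_mapsTo_pslQuotient_of_centralizer`):
  for `Γ ≤ N` free, of finite index in `N_N(Γ)`, with no nontrivial element of `N_N(Γ)` centralising
  `Γ`, over Mathlib's `ProfiniteGrp.ProfiniteCompletion.completion (GrpCat.of ↥(N_N Γ))` / `etaFn`.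

The consumer wiring at `X = ℍ/Γ̄` (inputs `C_{PSL₂(ℝ)}(Γ̄) = 1`, freeness of the objects of
`Loc(PSL₂(ℝ), Γ̄)`: abc-iut-L4-t14's `ArchimedeanHolFieldFunctorGeometricPSLCentralizer/PSLSlim`) is NOT
here.  Classical group theory; OUR kernel check; nothing here bears on [IUTchIII] Cor. 3.12.
-/

noncomputable section

namespace Literature.GroupTheory

open Literature.AlgebraicGeometry.Frobenioids (IsSlimGroup)
open Literature.IUT.HodgeTheaters (profiniteCompletion toCompletion)
open Literature.IUT.HodgeTheaters.ProfiniteCompletion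
open CategoryTheory ProfiniteGrp ProfiniteGrp.ProfiniteCompletion
open _root_.Topology

universe u

variable {M : Type u} [Group M]

/-- **`M̂` is slim.**  For `Λ ⊴ M` normal of finite index, free, with `C_M(Λ) = 1`, the profinite
completion `M̂` is slim: its open normal subgroup `Λ̂ = closure η(Λ) ≅ Λ̂` is slim (tree:
`isSlimGroup_profiniteCompletion_of_isFreeGroup`) with trivial centraliser (main theorem), and slimness
extends along such subgroups (`IsSlimGroup.of_normal_of_centralizer_eq_bot`).  This is [AbsTopIII]
Lemma 4.3 "`Π_{[X/Aut X]}` is slim" for `X` uniformised by a FREE `Λ̄` with `M = N(Λ̄)`, GIVEN the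
finiteness of `[M : Λ̄]` and `C_M(Λ̄) = 1`. [cite: MochizukiAbsTopIII2015, Proposition 4.2 (i) proof p.106] -/
theorem isSlimGroup_completion_of_isFreeGroup_normal (Λ : Subgroup M) [Λ.Normal] [Λ.FiniteIndex]
    [IsFreeGroup Λ] (hC : Subgroup.centralizer (Λ : Set M) = ⊥) :
    IsSlimGroup (profiniteCompletion M) := by
  classical
  -- degenerate case: `Λ` abelian forces `M`, hence `M̂`, trivial
  by_cases hab : ∃ a b : Λ, a * b ≠ b * a
  swap
  · refine ⟨fun U _ => ?_⟩
    rw [eq_bot_iff]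
    intro w _
    rw [Subgroup.mem_bot]
    refine eq_one_of_forall_commute_toCompletion Λ hC w fun l hl => ?_
    push Not at hab
    have hl1 : l = 1 := by
      have : l ∈ Subgroup.centralizer (Λ : Set M) := by
        rw [Subgroup.mem_centralizer_iff]
        intro l' hl'
        exact congrArg Subtype.val (hab ⟨l', hl'⟩ ⟨l, hl⟩)
      rwa [hC, Subgroup.mem_bot] at this
    rw [hl1, map_one, mul_one, one_mul]
  -- the closed subgroup `H = closure η(Λ)` of `M̂`
  let H : Subgroup (profiniteCompletion M) := (Λ.map (toCompletion M)).topologicalClosure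
  have hHK : (H : Set (profiniteCompletion M)) = closure (toCompletion M '' (Λ : Set M)) := by
    rw [Subgroup.topologicalClosure_coe, Subgroup.coe_map]
  have hmemH : ∀ w, w ∈ H ↔ w ∈ closure (toCompletion M '' (Λ : Set M)) := fun w => by
    rw [← SetLike.mem_coe, hHK]
  -- `H` is normal: it is the kernel of `M̂ → M ⧸ Λ`
  haveI : H.Normal := ⟨fun w hw g => by
    rw [hmemH, mem_closure_image_iff_val_eq_one] at hw ⊢
    let π : profiniteCompletion M →* M ⧸ Λ :=
      MonoidHom.mk' (fun w => (w.val (FiniteIndexNormalSubgroup.ofSubgroup Λ) : M ⧸ Λ)) fun _ _ => rfl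
    change π (g * w * g⁻¹) = 1
    change π w = 1 at hw
    rw [map_mul, map_mul, map_inv, hw, mul_one, mul_inv_cancel]⟩
  -- `H ≅ Λ̂` is slim
  obtain ⟨ι, hιc, hιi, hιη, hιr⟩ := exists_comparison Λ
  have hrange : ∀ z, ι z ∈ H := fun z => by
    rw [hmemH, ← hιr]; exact ⟨z, rfl⟩
  let f : profiniteCompletion Λ →* H := ι.codRestrict H hrange
  have hf_bij : Function.Bijective f := by
    refine ⟨fun z₁ z₂ h => hιi (congrArg Subtype.val h), fun w => ?_⟩
    have hw : (w : profiniteCompletion M) ∈ Set.range ι := by rw [hιr, ← hmemH]; exact w.2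
    obtain ⟨z, hz⟩ := hw
    exact ⟨z, Subtype.ext hz⟩
  have hf_cont : Continuous f := hιc.subtype_mk _
  let e₀ : profiniteCompletion Λ ≃* H := MulEquiv.ofBijective f hf_bij
  let eₜ : profiniteCompletion Λ ≃ₜ H :=
    Continuous.homeoOfEquivCompactToT2 (f := Equiv.ofBijective f hf_bij) hf_cont
  let e : profiniteCompletion Λ ≃ₜ* H :=
    { e₀ with
      continuous_toFun := hf_cont
      continuous_invFun := eₜ.continuous_symm }
  have hHslim : IsSlimGroup H :=
    Literature.AnabelianGeometry.AbsoluteAnabelian.IsSlimGroup.of_continuousMulEquiv_left e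
      (isSlimGroup_profiniteCompletion_of_isFreeGroup hab)
  -- `C_{M̂}(H) = 1` by the main theorem
  have hCH : Subgroup.centralizer (H : Set (profiniteCompletion M)) = ⊥ := by
    rw [eq_bot_iff]
    intro w hw
    rw [Subgroup.mem_centralizer_iff] at hw
    rw [Subgroup.mem_bot]
    refine eq_one_of_forall_commute_toCompletion Λ hC w fun l hl => (hw _ ?_).symm
    rw [SetLike.mem_coe, hmemH]
    exact subset_closure ⟨l, hl, rfl⟩
  exact IsSlimGroup.of_normal_of_centralizer_eq_bot H hHslim hCH

/-- **The normaliser shape** (hypothesis `h` of abc-iut-L4-t14's `LocObj.isIdRigid_of_completion_normalizer`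
and `HolRS.isIdRigid_mapsTo_pslQuotient_of_centralizer`, [AbsTopIII] Prop. 4.2 (i) p. 106): let
`Γ ≤ N` be a subgroup which is FREE, of FINITE INDEX in its normaliser `N_N(Γ)`, and such that no
nontrivial element of `N_N(Γ)` centralises `Γ`.  Then every element of the profinite completion of
`N_N(Γ)` commuting with `η(γ)` for all `γ ∈ Γ` is trivial.
[cite: MochizukiAbsTopIII2015, Proposition 4.2 (i) proof p.106] -/
theorem eq_one_of_forall_commute_etaFn_normalizer {N : Type u} [Group N] (Γ : Subgroup N)
    [(Γ.subgroupOf (Subgroup.normalizer (Γ : Set N))).FiniteIndex] (hΓ : IsFreeGroup Γ)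
    (hC : ∀ g ∈ Subgroup.normalizer (Γ : Set N), (∀ γ ∈ Γ, g * γ = γ * g) → g = 1)
    (y : completion (GrpCat.of (Subgroup.normalizer (Γ : Set N))))
    (hy : ∀ γ : Subgroup.normalizer (Γ : Set N), (γ : N) ∈ Γ →
      y * etaFn (GrpCat.of (Subgroup.normalizer (Γ : Set N))) γ =
        etaFn (GrpCat.of (Subgroup.normalizer (Γ : Set N))) γ * y) : y = 1 := by
  let Λ : Subgroup (Subgroup.normalizer (Γ : Set N)) := Γ.subgroupOf (Subgroup.normalizer (Γ : Set N))
  haveI : IsFreeGroup Λ :=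
    haveI := hΓ
    IsFreeGroup.ofMulEquiv (Subgroup.subgroupOfEquivOfLe (Subgroup.le_normalizer (H := Γ))).symm
  have hCΛ : Subgroup.centralizer (Λ : Set (Subgroup.normalizer (Γ : Set N))) = ⊥ := by
    rw [eq_bot_iff]
    intro g hg
    rw [Subgroup.mem_centralizer_iff] at hg
    rw [Subgroup.mem_bot]
    apply Subtype.ext
    refine hC g g.2 fun γ hγ => ?_
    have := hg ⟨γ, Subgroup.le_normalizer hγ⟩ (Subgroup.mem_subgroupOf.mpr hγ)
    exact (congrArg Subtype.val this).symm
  exact eq_one_of_forall_commute_toCompletion Λ hCΛ y fun l hl => hy l (Subgroup.mem_subgroupOf.mp hl)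

/-- The same in slimness form: under the hypotheses of `eq_one_of_forall_commute_etaFn_normalizer` the
profinite completion of the normaliser `N_N(Γ)` is SLIM ([AbsTopIII] Lemma 4.3 for `Π_{[X/Aut X]}` at a
free uniformising group, given `[N(Γ̄) : Γ̄] < ∞` and `C(Γ̄) ∩ N(Γ̄) = 1`).
[cite: MochizukiAbsTopIII2015, Proposition 4.2 (i) proof p.106] -/
theorem isSlimGroup_completion_normalizer {N : Type u} [Group N] (Γ : Subgroup N)
    [(Γ.subgroupOf (Subgroup.normalizer (Γ : Set N))).FiniteIndex] (hΓ : IsFreeGroup Γ)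
    (hC : ∀ g ∈ Subgroup.normalizer (Γ : Set N), (∀ γ ∈ Γ, g * γ = γ * g) → g = 1) :
    IsSlimGroup (completion (GrpCat.of (Subgroup.normalizer (Γ : Set N)))) := by
  let Λ : Subgroup (Subgroup.normalizer (Γ : Set N)) := Γ.subgroupOf (Subgroup.normalizer (Γ : Set N))
  haveI : IsFreeGroup Λ :=
    haveI := hΓ
    IsFreeGroup.ofMulEquiv (Subgroup.subgroupOfEquivOfLe (Subgroup.le_normalizer (H := Γ))).symm
  have hCΛ : Subgroup.centralizer (Λ : Set (Subgroup.normalizer (Γ : Set N))) = ⊥ := by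
    rw [eq_bot_iff]
    intro g hg
    rw [Subgroup.mem_centralizer_iff] at hg
    rw [Subgroup.mem_bot]
    apply Subtype.ext
    refine hC g g.2 fun γ hγ => ?_
    have := hg ⟨γ, Subgroup.le_normalizer hγ⟩ (Subgroup.mem_subgroupOf.mpr hγ)
    exact (congrArg Subtype.val this).symm
  exact isSlimGroup_completion_of_isFreeGroup_normal Λ hCΛ

end Literature.GroupTheory

end
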